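import Summits.RiemannHypothesis.RiemannHypothesis.Theorems.SpectralTraceWindowTraceArchStubCountingLawAux
import Summits.RiemannHypothesis.RiemannHypothesis.Theorems.WindowTraceArch.Negative.LocalWeyl
import HarnessLib

/-!
# The two-sided counting law of a witness (`stub_countingLaw`)

Stub `stub_countingLaw` of the line `defect-compactness-design` (wave 2: structure of witnesses)
for the crux `WindowTraceArch` (stmt-RiemannHypothesis-11195; skeleton
`Summit.RiemannHypothesis.RiemannHypothesis.Cruxes.WindowTraceArch.DefectCompactnessDesign`).

**Statement.** Assume (hypothesis 1, the statement of `stub_bandlimitedTest`) that for every witness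
`γ : ι → ℝ` of the crux — `Σᵢ ĝ(1/2 + iγᵢ) = W(g)` (`HasSum`) for every Weil test `g` supported in
`[-log 2, log 2]` — the same identity holds for every CONTINUOUS `g` supported in the window whose
transform decays like `M/(1 + u²)` on the critical line; and (hypothesis 2, the statement of
`stub_selbergTests`) that for every `T ≥ 0` there are continuous window tests `g±` with
`weilMellin g± (1/2 + zI) = F±(z)` for all complex `z`, `F± = selbergMajorant/Minorant Δ 0 T`
(`Δ = (log 2)/2π`), and `g±(0) = (T ± 2π/log 2)/(2π)`. Then every witness `γ` obeys the two-sided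
counting law: there is `C` with `{i : γ i ∈ [0, T]}` finite and
`|#{i : γ i ∈ [0, T]} − θ(T)/π| ≤ C (1 + log(1 + T))` for all `T ≥ 0` (`θ = riemannSiegelTheta`).

**Proof.** Finiteness is the local Weyl law (`finite_abs_le_of_windowTraceArch_witness`).
SPECTRAL SIDE (Beurling–Selberg): on the real line `F±(u)` is real with
`|F±(u)| ≤ K((1 + u²)⁻¹ + (1 + (u − T)²)⁻¹) ≤ K(1 + 2(1 + T²))/(1 + u²)`
(`exists_norm_selbergMajorant_le`), so hypothesis 1 applied to `g±` gives
`HasSum (F±(γᵢ)) W(g±)`, hence `HasSum (F±ℝ(γᵢ)) (Re W(g±))`; since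
`F₋ ≤ 𝟙_{[0,T]} ≤ F₊` pointwise (`selbergMinorantReal_le_indicator_Icc`,
`indicator_le_selbergMajorantReal`) and the indicator family has sum `#{i : γ i ∈ [0,T]}`
(finite support), `Re W(g₋) ≤ # ≤ Re W(g₊)` (`hasSum_le`). WEIL SIDE: by the auxiliary file
(`stub_countingLaw_archSide`: no prime term on the window, `ĝ±(0) = F±(i/2)`, `ĝ±(1) = F±(−i/2)`,
`θ(T)/π = (1/2π)∫₀ᵀ Re ψ(1/4 + iu/2) du − T log π/(2π)` by definition, and
`∫ |F± − 𝟙_{[0,T]}| |Re ψ| = O(1 + log(1+T))`) one has `|Re W(g±) − θ(T)/π| ≤ A + B log(1 + T)`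
with `A, B` independent of `T`; take `C = max A B`.

**Sources.** A. Selberg's majorant/minorant (J. D. Vaaler, *Some extremal functions in Fourier
analysis*, Bull. AMS 12 (1985), Thm. 8; tree `Literature/Analysis/Fourier/SelbergMajorants.lean`)
and the classical argument bounding a counting function between the sums of a band-limited
minorant and majorant (H. L. Montgomery, *Ten lectures on the interface between analytic number
theory and harmonic analysis* (1994), Ch. 1 §2). All ingredients are proved tree / Mathlib facts.
[folklore]
-/

set_option linter.dupNamespace false

noncomputable section

open Complex Filter Set MeasureTheory
open scoped Real Topology BigOperators

namespace Summit.RiemannHypothesis.RiemannHypothesis.Theorems.SpectralTraceWindowTraceArch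

open Literature.NumberTheory.LFunctions Literature.Analysis.Fourier
open Summit.RiemannHypothesis.RiemannHypothesis.Theorems.WindowTraceArch.Negative

/-- **stub_countingLaw — the two-sided counting law of a witness.** Given the statements of
`stub_bandlimitedTest` (the window identity for continuous band-limited tests) and of
`stub_selbergTests` (window tests `g±` whose transforms are Selberg's functions `F±` of `𝟙_{[0,T]}`
with bandwidth `(log 2)/2π`): for every witness `γ` of the crux there is `C` with
`#{i : γ i ∈ [0, T]} = θ(T)/π + E`, `|E| ≤ C(1 + log(1+T))` for all `T ≥ 0`, the set being finite
by the local Weyl law. Proof: `Σᵢ F±(γᵢ) = W(g±)` (hypothesis 1, decay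
`|F±(u)| ≤ K(1 + 2(1+T²))/(1+u²)` from `exists_norm_selbergMajorant_le`), the sums are real and
`F₋ ≤ 𝟙_{[0,T]} ≤ F₊` squeezes the count between them (`hasSum_le`), and
`|Re W(g±) − θ(T)/π| ≤ A + B log(1+T)` (`stub_countingLaw_archSide`). [folklore] -/
theorem stub_countingLaw :
    (∀ (ι : Type) (γ : ι → ℝ),
      (∀ g : ℝ → ℂ, Literature.NumberTheory.LFunctions.IsWeilTest g →
        tsupport g ⊆ Set.Icc (-Real.log 2) (Real.log 2) →
        HasSum (fun i => Literature.NumberTheory.LFunctions.weilMellin g (1 / 2 + (γ i : ℂ) * Complex.I))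
          (Literature.NumberTheory.LFunctions.weilFunctional g)) →
      ∀ (g : ℝ → ℂ) (M : ℝ), Continuous g → tsupport g ⊆ Set.Icc (-Real.log 2) (Real.log 2) →
        (∀ u : ℝ, ‖Literature.NumberTheory.LFunctions.weilMellin g (1 / 2 + (u : ℂ) * Complex.I)‖ ≤ M / (1 + u ^ 2)) →
        HasSum (fun i => Literature.NumberTheory.LFunctions.weilMellin g (1 / 2 + (γ i : ℂ) * Complex.I))
          (Literature.NumberTheory.LFunctions.weilFunctional g)) →
    (∀ T : ℝ, 0 ≤ T → ∃ gp gm : ℝ → ℂ, Continuous gp ∧ Continuous gm ∧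
      tsupport gp ⊆ Set.Icc (-Real.log 2) (Real.log 2) ∧ tsupport gm ⊆ Set.Icc (-Real.log 2) (Real.log 2) ∧
      (∀ z : ℂ, Literature.NumberTheory.LFunctions.weilMellin gp (1 / 2 + z * Complex.I) =
        Literature.Analysis.Fourier.selbergMajorant (Real.log 2 / (2 * Real.pi)) 0 T z) ∧
      (∀ z : ℂ, Literature.NumberTheory.LFunctions.weilMellin gm (1 / 2 + z * Complex.I) =
        Literature.Analysis.Fourier.selbergMinorant (Real.log 2 / (2 * Real.pi)) 0 T z) ∧
      gp 0 = (((T + 2 * Real.pi / Real.log 2) / (2 * Real.pi) : ℝ) : ℂ) ∧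
      gm 0 = (((T - 2 * Real.pi / Real.log 2) / (2 * Real.pi) : ℝ) : ℂ)) →
    ∀ (ι : Type) (γ : ι → ℝ),
      (∀ g : ℝ → ℂ, Literature.NumberTheory.LFunctions.IsWeilTest g →
        tsupport g ⊆ Set.Icc (-Real.log 2) (Real.log 2) →
        HasSum (fun i => Literature.NumberTheory.LFunctions.weilMellin g (1 / 2 + (γ i : ℂ) * Complex.I))
          (Literature.NumberTheory.LFunctions.weilFunctional g)) →
      ∃ C : ℝ, ∀ T : ℝ, 0 ≤ T →
        {i : ι | γ i ∈ Set.Icc 0 T}.Finite ∧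
        |(({i : ι | γ i ∈ Set.Icc 0 T}.ncard : ℕ) : ℝ) -
            Literature.NumberTheory.LFunctions.riemannSiegelTheta T / Real.pi| ≤ C * (1 + Real.log (1 + T)) := by
  intro H1 H2 ι γ hγ
  obtain ⟨A, B, hAB⟩ := stub_countingLaw_archSide
  refine ⟨max A B, fun T hT => ?_⟩
  obtain ⟨Δ, hΔ⟩ : ∃ Δ : ℝ, Δ = Real.log 2 / (2 * Real.pi) := ⟨_, rfl⟩
  rw [← hΔ] at H2 hAB
  have hΔ0 : 0 < Δ := by rw [hΔ]; exact div_pos (Real.log_pos one_lt_two) (by positivity)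
  obtain ⟨gp, gm, hgp, hgm, hgps, hgms, hmp, hmm, hgp0, hgm0⟩ := H2 T hT
  -- the set is finite (local Weyl law)
  set S : Set ι := {i : ι | γ i ∈ Set.Icc 0 T} with hS
  have hfin : S.Finite :=
    (finite_abs_le_of_windowTraceArch_witness hγ T).subset fun i hi =>
      abs_le.2 ⟨by linarith [hi.1], hi.2⟩
  refine ⟨hfin, ?_⟩
  -- decay of `F±` on the real line, in the form needed by `H1`
  have hdecay : ∀ (F : ℂ → ℂ) (K : ℝ),
      (∀ z : ℂ, ‖F z‖ ≤ K * Real.exp (2 * π * Δ * |z.im|) *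
        ((1 + (z.re - 0) ^ 2)⁻¹ + (1 + (z.re - T) ^ 2)⁻¹)) →
      ∀ u : ℝ, ‖F u‖ ≤ K * (1 + 2 * (1 + T ^ 2)) / (1 + u ^ 2) := by
    intro F K hK u
    have h := hK u
    simp only [Complex.ofReal_im, abs_zero, mul_zero, Real.exp_zero, mul_one, Complex.ofReal_re,
      sub_zero] at h
    have hK0 : 0 ≤ K := by
      have h0 := (norm_nonneg _).trans (hK 0)
      simp only [Complex.zero_im, abs_zero, mul_zero, Real.exp_zero, mul_one, Complex.zero_re,
        sub_zero] at h0
      have : 0 < (1 + (0:ℝ) ^ 2)⁻¹ + (1 + (0 - T) ^ 2)⁻¹ := by positivity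
      nlinarith
    have key : (1 + (u - T) ^ 2)⁻¹ ≤ 2 * (1 + T ^ 2) / (1 + u ^ 2) := by
      rw [inv_eq_one_div, div_le_div_iff₀ (by positivity) (by positivity)]
      nlinarith [sq_nonneg (u - 2 * T), sq_nonneg (T * (u - T)), sq_nonneg T, sq_nonneg (u - T)]
    calc ‖F u‖ ≤ K * ((1 + u ^ 2)⁻¹ + (1 + (u - T) ^ 2)⁻¹) := h
      _ ≤ K * ((1 + u ^ 2)⁻¹ + 2 * (1 + T ^ 2) / (1 + u ^ 2)) := by gcongr
      _ = K * (1 + 2 * (1 + T ^ 2)) / (1 + u ^ 2) := by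
          field_simp
  -- the two real sums
  have hsum_p : HasSum (fun i => selbergMajorantReal Δ 0 T (γ i)) (weilFunctional gp).re := by
    obtain ⟨K, -, hK⟩ := exists_norm_selbergMajorant_le hΔ0 0 T
    have hdec : ∀ u : ℝ, ‖weilMellin gp (1 / 2 + (u : ℂ) * Complex.I)‖ ≤
        K * (1 + 2 * (1 + T ^ 2)) / (1 + u ^ 2) := fun u => by
      rw [hmp]; exact hdecay _ K hK u
    have h := H1 ι γ hγ gp _ hgp hgps hdec
    have h' : HasSum (fun i => ((selbergMajorantReal Δ 0 T (γ i) : ℝ) : ℂ)) (weilFunctional gp) :=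
      h.congr_fun fun i => by rw [hmp, selbergMajorant_ofReal]
    simpa using Complex.hasSum_re h'
  have hsum_m : HasSum (fun i => selbergMinorantReal Δ 0 T (γ i)) (weilFunctional gm).re := by
    obtain ⟨K, -, hK⟩ := exists_norm_selbergMinorant_le hΔ0 0 T
    have hdec : ∀ u : ℝ, ‖weilMellin gm (1 / 2 + (u : ℂ) * Complex.I)‖ ≤
        K * (1 + 2 * (1 + T ^ 2)) / (1 + u ^ 2) := fun u => by
      rw [hmm]; exact hdecay _ K hK u
    have h := H1 ι γ hγ gm _ hgm hgms hdec
    have h' : HasSum (fun i => ((selbergMinorantReal Δ 0 T (γ i) : ℝ) : ℂ)) (weilFunctional gm) :=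
      h.congr_fun fun i => by rw [hmm, selbergMinorant_ofReal]
    simpa using Complex.hasSum_re h'
  -- the count, squeezed between the two sums
  classical
  have hcard : (S.ncard : ℝ) =
      ∑ i ∈ hfin.toFinset, (Set.Icc 0 T).indicator (fun _ => (1 : ℝ)) (γ i) := by
    rw [Set.ncard_eq_toFinset_card S hfin, Finset.sum_congr rfl fun i hi => Set.indicator_of_mem
      (show γ i ∈ Set.Icc 0 T from (Set.Finite.mem_toFinset hfin).1 hi) _,
      Finset.sum_const, nsmul_eq_mul, mul_one]
  have hind : HasSum (fun i => (Set.Icc 0 T).indicator (fun _ => (1 : ℝ)) (γ i)) (S.ncard : ℝ) := by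
    rw [hcard]
    refine hasSum_sum_of_ne_finset_zero fun i hi => ?_
    exact Set.indicator_of_notMem
      (show γ i ∉ Set.Icc 0 T from fun h => hi ((Set.Finite.mem_toFinset hfin).2 h)) _
  have hup : (S.ncard : ℝ) ≤ (weilFunctional gp).re :=
    hasSum_le (fun i => indicator_le_selbergMajorantReal hΔ0 hT (γ i)) hind hsum_p
  have hlow : (weilFunctional gm).re ≤ (S.ncard : ℝ) :=
    hasSum_le (fun i => selbergMinorantReal_le_indicator_Icc hΔ0 0 T (γ i)) hsum_m hind
  -- the Weil side
  have hp := hAB T hT gp hgp hgps (Or.inl ⟨hmp, hgp0⟩)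
  have hm := hAB T hT gm hgm hgms (Or.inr ⟨hmm, hgm0⟩)
  have hlogT : 0 ≤ Real.log (1 + T) := Real.log_nonneg (by linarith)
  have hA : A ≤ max A B := le_max_left _ _
  have hB : B * Real.log (1 + T) ≤ max A B * Real.log (1 + T) :=
    mul_le_mul_of_nonneg_right (le_max_right _ _) hlogT
  rw [abs_le] at hp hm ⊢
  constructor <;> nlinarith [hp.1, hp.2, hm.1, hm.2]

end Summit.RiemannHypothesis.RiemannHypothesis.Theorems.SpectralTraceWindowTraceArch

end
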